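import Literature.NumberTheory.Automorphic.GLnIntegralLeviUnipotent
import Literature.NumberTheory.Automorphic.GLnUnipotentRadicalUnimodular
import Literature.MeasureTheory.Group.InvariantQuotientNormalized
import HarnessLib

/-!
# The Iwasawa form of the CANONICAL quotient measure on `GL_n(F) ⧸ M_c(F)`: with the `vol(K) = 1`
# normalisations the constant is ONE, `ν ∕ ν_M = ((k, u) ↦ k u M_c)_* (κ ⊗ μ_U)`

Topic `NumberTheory/Automorphic`; namespace `Literature.NumberTheory.Automorphic`. KERNEL
mathematics only: theorems, no definition, no named fact, no instance, no `sorry`. Road «D-S1», gap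
«D-S1c-canonical» (g1) of the unit fundamental lemma at a split place: ★
`GLnLeviQuotientIwasawaIntegration.exists_quotientMeasure_levi_eq_smul_map` gives, for EVERY non-zero
invariant Radon measure `μ` on `G ⧸ M_c` (`G = GL_n(F)`, `c` monotone) and Haar measures `κ` on
`K = GL_n(𝒪)`, `μ_U` on `U_c(F)`, a constant `C ≠ 0` with `μ = C • ((k, u) ↦ k u M_c)_* (κ ⊗ μ_U)`.
Here the constant is PINNED for the data of Rogawski 1990, §4.9 p. 54 («Haar measures normalised by
`vol(K) = 1`») and §4.3 (4.3.1) p. 43 («compatible» quotient measures `dg = dġ dm`): for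
`μ = ν ∕ ν_M` the canonical quotient of Haar measures (★ `Literature.MeasureTheory.Group.quotientMeasure`,
Weil's formula with constant one ★ `lintegral_fiberLIntegral_quotientMeasure`, Deitmar–Echterhoff
Thm. 1.5.3) with `ν(K) = 1`, `ν_M(M_c ∩ K) = 1`, and `κ(K) = 1`, `μ_U(U_c ∩ K) = 1`, one has `C = 1`.
Test function `1_K`: by Weil `∫_{G⧸M} (1_K)^{M} d(ν∕ν_M) = ν(K) = 1`, while the fibre integral of `1_K`
at `k u` is `1_K(u) ν_M(M_c ∩ K)` (★ `levi_mul_unipotent_mem_glInt_iff`: `m v ∈ K ↔ m ∈ K ∧ v ∈ K` for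
`m ∈ M_c`, `v ∈ U_c`), so the Iwasawa side is `C κ(K) μ_U(U_c ∩ K) ν_M(M_c ∩ K) = C`.

* `lintegral_levi_indicator_glInt_mul` — for `k ∈ K`, `u ∈ U_c` and any measure `ν_M` on `A = M_c`:
  `∫⁻_{A} 1_K(k u m) dν_M(m) = 1_K(u) · ν_M(A ∩ K)`.
* **`quotientMeasure_levi_eq_map`** — `ν ∕ ν_M = ((k, u) ↦ k u M_c)_* (κ ⊗ μ_U)` under the four
  normalisations (monotone `c`, any number of blocks).
* `lintegral_quotientMeasure_levi_eq`, `lintegral_descConj_quotientMeasure_levi_eq` — the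
  integration formulas with constant ONE: `∫⁻_{G ⧸ M_c} f d(ν∕ν_M) = ∫⁻_{K × U_c} f(k u M_c) d(κ ⊗ μ_U)`
  (`f` Borel) and `∫⁻_{G ⧸ M_c} F(y γ y⁻¹) d(ν∕ν_M) = ∫⁻_{K × U_c} F((k u) γ (k u)⁻¹) d(κ ⊗ μ_U)`
  (`γ` centralised by `M_c`, `F` Borel).

## References

* [Rogawski1990] J. D. Rogawski, *Automorphic Representations of Unitary Groups in Three Variables*,
  Ann. of Math. Stud. 123 (1990), §4.3 (4.3.1) p. 43, §4.9 p. 54, §4.13 proof of Lemma 4.13.1 p. 70.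
* [DeitmarEchterhoff2014] A. Deitmar, S. Echterhoff, *Principles of Harmonic Analysis*, 2nd ed.
  (2014), Thm. 1.5.3 (quotient integral formula).
-/

set_option autoImplicit false

noncomputable section

open scoped MatrixGroups NNReal ENNReal
open MeasureTheory Measure Matrix Topology

namespace Literature.NumberTheory.Automorphic

open Literature.MeasureTheory.Group
open Literature.NumberTheory.GaloisRepresentations.IsNonarchimedeanLocalField

section Canonical

variable (F : Type*) [Field F] [ValuativeRel F] [TopologicalSpace F] [IsNonarchimedeanLocalField F]
  {n : ℕ} {α : Type*} [LinearOrder α] [Fintype α] {c : Fin n → α}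
  [MeasurableSpace (GL (Fin n) F)] [BorelSpace (GL (Fin n) F)]

omit [TopologicalSpace F] [IsNonarchimedeanLocalField F] [MeasurableSpace (GL (Fin n) F)]
  [BorelSpace (GL (Fin n) F)] in
/-- For `k ∈ K = GL_n(𝒪)`, `u ∈ U_c` and `m ∈ M_c`: **`k u m ∈ K ↔ u ∈ K ∧ m ∈ K`** — write
`u m = m (m⁻¹ u m)` with `m⁻¹ u m ∈ U_c` and use ★ `levi_mul_unipotent_mem_glInt_iff`.
[cite: Rogawski1990, §4.13, proof of Lemma 4.13.1, p. 70] -/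
theorem glInt_mul_unipotent_mul_levi_mem_glInt_iff {k u m : GL (Fin n) F} (hk : k ∈ glInt n F)
    (hu : u ∈ unipotentRadicalGL F c) (hm : m ∈ standardLeviGL F c) :
    k * u * m ∈ glInt n F ↔ u ∈ glInt n F ∧ m ∈ glInt n F := by
  have hconj : m⁻¹ * u * m ∈ unipotentRadicalGL F c := by
    have h := conj_mem_unipotentRadicalGL_of_mem_standardLeviGL (R := F) (c := c)
      (Subgroup.inv_mem _ hm) hu
    rwa [inv_inv] at h
  have hsplit : k * u * m = k * (m * (m⁻¹ * u * m)) := by group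
  rw [hsplit, Subgroup.mul_mem_cancel_left _ hk, levi_mul_unipotent_mem_glInt_iff hm hconj]
  constructor
  · rintro ⟨hmK, h⟩
    refine ⟨?_, hmK⟩
    have h' := Subgroup.mul_mem _ (Subgroup.mul_mem _ hmK h) (Subgroup.inv_mem _ hmK)
    rwa [show m * (m⁻¹ * u * m) * m⁻¹ = u by group] at h'
  · rintro ⟨huK, hmK⟩
    exact ⟨hmK, Subgroup.mul_mem _ (Subgroup.mul_mem _ (Subgroup.inv_mem _ hmK) huK) hmK⟩

omit [TopologicalSpace F] [IsNonarchimedeanLocalField F] [MeasurableSpace (GL (Fin n) F)]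
  [BorelSpace (GL (Fin n) F)] in
/-- **The fibre integral of `1_K` over the Levi subgroup**: for `k ∈ K = GL_n(𝒪)`, `u ∈ U_c`, any
measure `ν_M` on `A = M_c` (any measurable structure on `GL_n(F)` making `K` measurable),
`∫⁻_{A} 1_K(k u m) dν_M(m) = 1_K(u) · ν_M(A ∩ K)` (`glInt_mul_unipotent_mul_levi_mem_glInt_iff`).
[cite: Rogawski1990, §4.13, proof of Lemma 4.13.1, p. 70] -/
theorem lintegral_levi_indicator_glInt_mul [MeasurableSpace (GL (Fin n) F)]
    (hK : MeasurableSet (glInt n F : Set (GL (Fin n) F)))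
    {A : Subgroup (GL (Fin n) F)} (hA : A = standardLeviGL F c) (νA : Measure ↥A)
    {k u : GL (Fin n) F} (hk : k ∈ glInt n F) (hu : u ∈ unipotentRadicalGL F c) :
    ∫⁻ m : ↥A, (glInt n F : Set (GL (Fin n) F)).indicator 1 (k * u * (m : GL (Fin n) F)) ∂νA =
      (glInt n F : Set (GL (Fin n) F)).indicator 1 u *
        νA (Subtype.val ⁻¹' (glInt n F : Set (GL (Fin n) F))) := by
  classical
  subst hA
  have hval : MeasurableSet
      (Subtype.val ⁻¹' (glInt n F : Set (GL (Fin n) F)) : Set ↥(standardLeviGL F c)) :=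
    measurable_subtype_coe hK
  have hpt : ∀ m : ↥(standardLeviGL F c),
      (glInt n F : Set (GL (Fin n) F)).indicator (1 : GL (Fin n) F → ℝ≥0∞)
          (k * u * (m : GL (Fin n) F)) =
        (glInt n F : Set (GL (Fin n) F)).indicator 1 u *
          (Subtype.val ⁻¹' (glInt n F : Set (GL (Fin n) F)) : Set ↥(standardLeviGL F c)).indicator
            1 m := by
    intro m
    have hiff := glInt_mul_unipotent_mul_levi_mem_glInt_iff F (c := c) hk hu m.2
    by_cases huK : u ∈ glInt n F
    · by_cases hmK : (m : GL (Fin n) F) ∈ glInt n F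
      · rw [Set.indicator_of_mem (hiff.2 ⟨huK, hmK⟩), Set.indicator_of_mem huK,
          Set.indicator_of_mem (show m ∈ Subtype.val ⁻¹' (glInt n F : Set (GL (Fin n) F)) from hmK)]
        simp
      · rw [Set.indicator_of_notMem (fun h => hmK (hiff.1 h).2),
          Set.indicator_of_notMem
            (show m ∉ Subtype.val ⁻¹' (glInt n F : Set (GL (Fin n) F)) from hmK), mul_zero]
    · rw [Set.indicator_of_notMem (fun h => huK (hiff.1 h).1), Set.indicator_of_notMem huK,
        zero_mul]
  simp_rw [hpt]
  rw [lintegral_const_mul' _ _ (by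
        by_cases huK : u ∈ glInt n F
        · rw [Set.indicator_of_mem huK]; simp
        · rw [Set.indicator_of_notMem huK]; exact ENNReal.zero_ne_top),
    lintegral_indicator_one hval]

/-- **The canonical quotient measure on `GL_n(F) ⧸ M_c(F)` in Iwasawa coordinates — constant ONE**
(Rogawski 1990, §4.3 (4.3.1), §4.9: measures normalised by `vol(K) = 1`). Let `c` be monotone,
`A = M_c`, `ν` a Haar measure on `GL_n(F)` with `ν(K) = 1`, `ν_M` a Haar measure on `A` with
`ν_M(A ∩ K) = 1`, `κ` the Haar probability measure on `K = GL_n(𝒪)`, `μ_U` a Haar measure on `U_c` with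
`μ_U(U_c ∩ K) = 1`. Then the canonical quotient measure `ν ∕ ν_M` (★ `quotientMeasure`) IS the image
of `κ ⊗ μ_U` under `(k, u) ↦ k u A`:
`quotientMeasure A ν_M ν = ((k, u) ↦ k u A)_* (κ ⊗ μ_U)`.
Proof: ★ `exists_quotientMeasure_levi_eq_smul_map` gives `ν ∕ ν_M = C • (…)_* (κ ⊗ μ_U)`; integrate
the fibre integral of `1_K` (`lintegral_levi_indicator_glInt_mul`): Weil's formula with constant one
gives `ν(K) = 1` on the left and `C κ(K) μ_U(U_c ∩ K) ν_M(A ∩ K) = C` on the right.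
[cite: Rogawski1990, §4.3 (4.3.1) p. 43; §4.9 p. 54; §4.13 proof of Lemma 4.13.1 p. 70]
[cite: DeitmarEchterhoff2014, Thm. 1.5.3] -/
theorem quotientMeasure_levi_eq_map
    [T2Space (GL (Fin n) F)] [SecondCountableTopology (GL (Fin n) F)]
    [LocallyCompactSpace (GL (Fin n) F)]
    (hc : Monotone c) {A : Subgroup (GL (Fin n) F)} (hA : A = standardLeviGL F c)
    (hAc : IsClosed (A : Set (GL (Fin n) F)))
    [MeasurableSpace (GL (Fin n) F ⧸ A)] [BorelSpace (GL (Fin n) F ⧸ A)]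
    (ν : Measure (GL (Fin n) F)) [IsHaarMeasure ν] [ν.IsMulRightInvariant]
    (hνK : ν (glInt n F : Set (GL (Fin n) F)) = 1)
    (νA : Measure ↥A) [IsHaarMeasure νA] [νA.IsInvInvariant]
    (hνA : νA (Subtype.val ⁻¹' (glInt n F : Set (GL (Fin n) F))) = 1)
    (κ : Measure ↥(glInt n F)) [IsHaarMeasure κ] (hκ : κ Set.univ = 1)
    (μN : Measure ↥(unipotentRadicalGL F c)) [IsHaarMeasure μN]
    (hμN : μN (Subtype.val ⁻¹' (glInt n F : Set (GL (Fin n) F))) = 1) :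
    quotientMeasure A νA hAc ν = Measure.map
      (fun p : ↥(glInt n F) × ↥(unipotentRadicalGL F c) =>
        (QuotientGroup.mk ((p.1 : GL (Fin n) F) * (p.2 : GL (Fin n) F)) : GL (Fin n) F ⧸ A))
      (κ.prod μN) := by
  haveI : T2Space F := (isLocalField F).toT2Space
  haveI : IsClosed (A : Set (GL (Fin n) F)) := hAc
  haveI : BorelSpace ↥(unipotentRadicalGL F c) := Subtype.borelSpace _
  haveI : BorelSpace ↥(glInt n F) := Subtype.borelSpace _
  haveI : μN.IsInvInvariant := isInvInvariant_haar_unipotentRadicalGL_of_monotone F hc μN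
  haveI : SecondCountableTopology ↥A := TopologicalSpace.Subtype.secondCountableTopology _
  haveI : LocallyCompactSpace ↥A := hAc.isClosedEmbedding_subtypeVal.locallyCompactSpace
  haveI : SFinite νA := inferInstance
  haveI : SecondCountableTopology ↥(glInt n F) := TopologicalSpace.Subtype.secondCountableTopology _
  haveI : SecondCountableTopology ↥(unipotentRadicalGL F c) :=
    TopologicalSpace.Subtype.secondCountableTopology _
  haveI : LocallyCompactSpace ↥(unipotentRadicalGL F c) :=
    (isClosed_unipotentRadicalGL (R := F) c).isClosedEmbedding_subtypeVal.locallyCompactSpace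
  haveI : SFinite μN := inferInstance
  haveI : BorelSpace (↥(glInt n F) × ↥(unipotentRadicalGL F c)) := Prod.borelSpace
  set μ := quotientMeasure A νA hAc ν with hμdef
  have hμ0 : μ ≠ 0 := quotientMeasure_ne_zero A νA hAc ν
  obtain ⟨C, hC, hμ⟩ := exists_quotientMeasure_levi_eq_smul_map F hc hA μ hμ0 κ μN
  -- the test function `1_K` and its fibre integral
  have hK : MeasurableSet (glInt n F : Set (GL (Fin n) F)) := (isOpen_glInt n F).measurableSet
  set f : GL (Fin n) F → ℝ≥0∞ := (glInt n F : Set (GL (Fin n) F)).indicator 1 with hfdef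
  have hf : Measurable f := measurable_one.indicator hK
  have hφ : Measurable (fun p : ↥(glInt n F) × ↥(unipotentRadicalGL F c) =>
      (QuotientGroup.mk ((p.1 : GL (Fin n) F) * (p.2 : GL (Fin n) F)) : GL (Fin n) F ⧸ A)) :=
    ((QuotientGroup.continuous_mk (N := A)).comp
      ((continuous_subtype_val.comp continuous_fst).mul
        (continuous_subtype_val.comp continuous_snd))).measurable
  -- Weil's formula with constant one: `∫ (1_K)^A d(ν/ν_M) = ν(K) = 1`
  have hW : ∫⁻ x, fiberLIntegral A νA f x ∂μ = 1 := by
    rw [hμdef, lintegral_fiberLIntegral_quotientMeasure A νA ν hf, hfdef,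
      lintegral_indicator_one hK, hνK]
  -- the same integral in Iwasawa coordinates: `C κ(K) μ_U(U ∩ K) ν_M(A ∩ K) = C`
  have hfib : ∀ p : ↥(glInt n F) × ↥(unipotentRadicalGL F c),
      fiberLIntegral A νA f
          (QuotientGroup.mk ((p.1 : GL (Fin n) F) * (p.2 : GL (Fin n) F)) : GL (Fin n) F ⧸ A) =
        (Subtype.val ⁻¹' (glInt n F : Set (GL (Fin n) F)) :
            Set ↥(unipotentRadicalGL F c)).indicator 1 p.2 := by
    intro p
    rw [fiberLIntegral_mk, hfdef, lintegral_levi_indicator_glInt_mul F hK hA νA p.1.2 p.2.2, hνA,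
      mul_one]
    rfl
  have hI : ∫⁻ x, fiberLIntegral A νA f x ∂μ = C := by
    rw [hμ, lintegral_smul_measure, lintegral_map (measurable_fiberLIntegral A νA hf) hφ]
    simp_rw [hfib]
    rw [lintegral_prod _ (Measurable.aemeasurable (by
          exact (measurable_one.indicator (measurable_subtype_coe hK)).comp measurable_snd))]
    dsimp only
    rw [lintegral_indicator_one (measurable_subtype_coe hK), lintegral_const, hμN, hκ, mul_one,
      ENNReal.smul_def, smul_eq_mul, mul_one]
  have hC1 : C = 1 := by
    have h := hI.symm.trans hW
    exact_mod_cast h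
  rw [hμ, hC1, one_smul]

/-- **Integration over `GL_n(F) ⧸ M_c(F)` against the canonical quotient measure, constant ONE**:
under the normalisations of `quotientMeasure_levi_eq_map`, for every Borel `f ≥ 0` on `G ⧸ A`,
`∫⁻_{G ⧸ A} f d(ν ∕ ν_M) = ∫⁻_{K × U_c} f(k u A) d(κ ⊗ μ_U)`.
[cite: Rogawski1990, §4.3 (4.3.1) p. 43; §4.9 p. 54] [cite: DeitmarEchterhoff2014, Thm. 1.5.3] -/
theorem lintegral_quotientMeasure_levi_eq
    [T2Space (GL (Fin n) F)] [SecondCountableTopology (GL (Fin n) F)]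
    [LocallyCompactSpace (GL (Fin n) F)]
    (hc : Monotone c) {A : Subgroup (GL (Fin n) F)} (hA : A = standardLeviGL F c)
    (hAc : IsClosed (A : Set (GL (Fin n) F)))
    [MeasurableSpace (GL (Fin n) F ⧸ A)] [BorelSpace (GL (Fin n) F ⧸ A)]
    (ν : Measure (GL (Fin n) F)) [IsHaarMeasure ν] [ν.IsMulRightInvariant]
    (hνK : ν (glInt n F : Set (GL (Fin n) F)) = 1)
    (νA : Measure ↥A) [IsHaarMeasure νA] [νA.IsInvInvariant]
    (hνA : νA (Subtype.val ⁻¹' (glInt n F : Set (GL (Fin n) F))) = 1)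
    (κ : Measure ↥(glInt n F)) [IsHaarMeasure κ] (hκ : κ Set.univ = 1)
    (μN : Measure ↥(unipotentRadicalGL F c)) [IsHaarMeasure μN]
    (hμN : μN (Subtype.val ⁻¹' (glInt n F : Set (GL (Fin n) F))) = 1)
    {f : GL (Fin n) F ⧸ A → ℝ≥0∞} (hf : Measurable f) :
    ∫⁻ x, f x ∂quotientMeasure A νA hAc ν =
      ∫⁻ p : ↥(glInt n F) × ↥(unipotentRadicalGL F c),
        f (QuotientGroup.mk ((p.1 : GL (Fin n) F) * (p.2 : GL (Fin n) F))) ∂(κ.prod μN) := by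
  haveI : BorelSpace ↥(unipotentRadicalGL F c) := Subtype.borelSpace _
  haveI : BorelSpace ↥(glInt n F) := Subtype.borelSpace _
  haveI : BorelSpace (↥(glInt n F) × ↥(unipotentRadicalGL F c)) := Prod.borelSpace
  have hφ : Measurable (fun p : ↥(glInt n F) × ↥(unipotentRadicalGL F c) =>
      (QuotientGroup.mk ((p.1 : GL (Fin n) F) * (p.2 : GL (Fin n) F)) : GL (Fin n) F ⧸ A)) :=
    ((QuotientGroup.continuous_mk (N := A)).comp
      ((continuous_subtype_val.comp continuous_fst).mul
        (continuous_subtype_val.comp continuous_snd))).measurable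
  rw [quotientMeasure_levi_eq_map F hc hA hAc ν hνK νA hνA κ hκ μN hμN, lintegral_map hf hφ]

/-- **The orbital integrand against the canonical quotient measure, constant ONE**: under the
normalisations of `quotientMeasure_levi_eq_map`, for every `γ` centralised by `A = M_c` and every
Borel `F ≥ 0` on `GL_n(F)`,
`∫⁻_{G ⧸ A} F(y γ y⁻¹) d(ν ∕ ν_M) = ∫⁻_{K × U_c} F((k u) γ (k u)⁻¹) d(κ ⊗ μ_U)` — the «`dg = dk du dm`»
form of Rogawski's orbital integral at an `M`-central point with his normalisations.
[cite: Rogawski1990, §4.3 (4.3.1) p. 43; §4.9 p. 54; §4.13 proof of Lemma 4.13.1 p. 70]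
[cite: DeitmarEchterhoff2014, Thm. 1.5.3] -/
theorem lintegral_descConj_quotientMeasure_levi_eq
    [T2Space (GL (Fin n) F)] [SecondCountableTopology (GL (Fin n) F)]
    [LocallyCompactSpace (GL (Fin n) F)]
    (hc : Monotone c) {A : Subgroup (GL (Fin n) F)} (hA : A = standardLeviGL F c)
    (hAc : IsClosed (A : Set (GL (Fin n) F)))
    [MeasurableSpace (GL (Fin n) F ⧸ A)] [BorelSpace (GL (Fin n) F ⧸ A)]
    (ν : Measure (GL (Fin n) F)) [IsHaarMeasure ν] [ν.IsMulRightInvariant]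
    (hνK : ν (glInt n F : Set (GL (Fin n) F)) = 1)
    (νA : Measure ↥A) [IsHaarMeasure νA] [νA.IsInvInvariant]
    (hνA : νA (Subtype.val ⁻¹' (glInt n F : Set (GL (Fin n) F))) = 1)
    (κ : Measure ↥(glInt n F)) [IsHaarMeasure κ] (hκ : κ Set.univ = 1)
    (μN : Measure ↥(unipotentRadicalGL F c)) [IsHaarMeasure μN]
    (hμN : μN (Subtype.val ⁻¹' (glInt n F : Set (GL (Fin n) F))) = 1)
    (γ : GL (Fin n) F) (hγ : ∀ a ∈ A, a * γ = γ * a)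
    {Fn : GL (Fin n) F → ℝ≥0∞} (hFn : Measurable Fn) :
    ∫⁻ y, descConj γ A hγ Fn y ∂quotientMeasure A νA hAc ν =
      ∫⁻ p : ↥(glInt n F) × ↥(unipotentRadicalGL F c),
        Fn ((p.1 : GL (Fin n) F) * (p.2 : GL (Fin n) F) * γ *
          ((p.1 : GL (Fin n) F) * (p.2 : GL (Fin n) F))⁻¹) ∂(κ.prod μN) := by
  rw [lintegral_quotientMeasure_levi_eq F hc hA hAc ν hνK νA hνA κ hκ μN hμN
    (measurable_descConj γ A hγ hFn)]
  simp_rw [descConj_mk]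

end Canonical

end Literature.NumberTheory.Automorphic
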